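import Summits.BirchSwinnertonDyer.Rank1Residual.P2.PrintCf2GenusPeriodTransferLayerBlocks
import Summits.BirchSwinnertonDyer.Rank1Residual.P2.CongruentNumberSilentEvenFiveThetaRecursion
import HarnessLib

/-!
# Crux `PrintCf2.RamifiedOffTYZOfFacts` (item stmt-BirchSwinnertonDyer-20509; items 23431/23432 of route `PrintCf2` rev ≥ 33),
# line `offtyz-v7`: FROM THE GENUS PERIOD `Z(d)` TO THE GENUS POINT `P(d)` — every automorphism trivial on `L_n(i)` moves every `P(d₀)`
# and every `Z(d₀)` by an INTEGER MULTIPLE OF `τ(1)`; `g·P(d) = P(d) + a·τ(1)` whenever `g·Z(d) = Z(d) + a·τ(1)` and each lower term of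
# the recursion contributes an EVEN multiple (kernel bookkeeping for the GALOIS-MOVER DOOR)

Cell `bsd-print-cf2`, seat `bsd-print-cf2-ty2` (typer; the DISCHARGE INTERFACE), companion of `PrintCf2GenusPeriodTransferLayer{,Blocks}.lean`
(THEOREM B at layer 1: `g·Z(d) = Z(d) + [g^{g(d)} ≡ σ]·τ(1)`) for the LEAD's note `Cruxes/RamifiedOffTYZOfFacts/Lines/offtyz_v7_TransferLayer.md`
§5.2 / §10 («LAYER-1 CLASS of `R(n)` over `L_n(i)` = `Σ_{d∣n, d≡5(8), d=n or 𝓛(n/d) odd} χ^{(1)}_d`»; single-term families: every lower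
`𝓛(n/d₀)` even).  The door `GaloisMotion.rankOne_sha_bsdp_two_congruentNumberCurve_of_selmerEight_of_mover` (p672160) wants a mover of the
genus POINT `P(n)`; `GaloisMotion.galPt_genusPoint_ne_iff_galPt_genusPeriod_ne` (p671505) reduces this to `Z(n)` when `g` FIXES the lower sum
of the recursion; this file supplies the general bookkeeping of that lower sum.  HONEST FRAMING: theorems only (no `def`, no named fact, no
`sorry`); nothing here closes an item; BSD is not proved by any of this; no class is closed.  beyond-print theorem: NO.

* §1 `τ(1)`-arithmetic under the CM action and integer scalars: `galPt_cmIPow_of_fix` (`g` fixing `i` commutes with `[i]^k`),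
  `cmIPow_nsmul_tauOne`, `zsmul_nsmul_tauOne` (`L • (b•τ(1)) = (|L| b)•τ(1)`), `neg_nsmul_tauOne`.
* §2 `P_eq_Z_of_prime` — for a PRIME block `p ∣ n` the recursion is empty (`ThetaDescent.recursionIndex_prime` of route B, `CongruentNumberSilentEvenFiveThetaRecursion.lean`): `P(p) = Z(p)`.
* §3 `exists_galPt_Z_eq_add_nsmul_of_cmBlockSpec` — on every block `d₀ ≡ 5, 6 (mod 8)` of `CMPointGaloisPrinted`, every `g` trivial on `L_{d₀}(i)`
  has `g·Z(d₀) = Z(d₀) + m·τ(1)` for some `m : ℕ` (the tree's `ThetaDescent.sum_thetaPt_reindex` = TYZ p. 759 «`Z(n)^α − Z(n) ∈ ℤτ(1)`»;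
  no parity claimed here — the parity is THEOREM B).
* §4 `galPt_recursionSum_eq_add`, **`galPt_P_eq_add_of_even_mul`** — if `g(i) = i`, `g·Z(d) = Z(d) + a·τ(1)` and every `d₀ ∈ recursionIndex d`
  has `g·P(d₀) = P(d₀) + m(d₀)·τ(1)` with `𝓛(d/d₀)·m(d₀)` EVEN, then `g·P(d) = P(d) + a·τ(1)`; hence (`galPt_P_ne_iff_of_even_mul`)
  `g·P(d) ≠ P(d) ⟺ g·Z(d) ≠ Z(d)`.
* §5 `exists_galPt_P_eq_add_nsmul` — by strong induction over the blocks: given that every block's `Z` moves by a multiple of `τ(1)` under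
  `g`, so does every block's `P` (the `m(d₀)` of §4 exist).

References: [cite: TianYuanZhang2017, §3.1 (p0011 L53–L73: Z(n), the recursion for P(n)), proof of Lemma 3.21 (p0020 L27–L63: Z(n)^α − Z(n) ∈ ℤτ(1)), Lemma 3.16 (p0017 L105–L113: τ(1))];
the LEAD note (crux dir) §5.2, §10; p671505 (`GaloisMotion`), p672160 (door).
-/

noncomputable section

open scoped Classical

open WeierstrassCurve WeierstrassCurve.Affine Literature.NumberTheory.EllipticCurves
  Literature.NumberTheory.EllipticCurves.TianYuanZhang2017
  Literature.NumberTheory.EllipticCurves.TianYuanZhang2017.W2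

set_option autoImplicit false

namespace Summit.BirchSwinnertonDyer.Rank1Residual.P2.GenusPeriodTransferLayer

open Summit.BirchSwinnertonDyer.Rank1Residual.P2.ThetaDescent Finset

variable {n : ℕ} (D : GenusPointData n)

/-! ## §1 `τ(1)`-arithmetic -/

/-- An automorphism fixing `i` commutes with `[i]^k` on `A(ℍ′_n)`. [cite: TianYuanZhang2017, §3.1 (p0011 L66: A(ℍ′_n) is a ℤ[i]-module)] -/
theorem galPt_cmIPow_of_fix (g : D.H ≃ₐ[ℚ] D.H) (hgi : g D.im = D.im) (k : ℕ) (Q : APoint D.H) :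
    D.galPt g (cmIPow D.im D.im_sq k Q) = cmIPow D.im D.im_sq k (D.galPt g Q) := by
  induction k generalizing Q with
  | zero => rfl
  | succ k ih =>
    show D.galPt g (D.iPt (cmIPow D.im D.im_sq k Q)) = D.iPt (cmIPow D.im D.im_sq k (D.galPt g Q))
    rw [← ih]
    exact thetaPt_iPt_of_fix D g hgi _

/-- `[i]^k (m·τ(1)) = m·τ(1)` (`[i]τ(1) = τ(1)`). [cite: TianYuanZhang2017, §3.2 (p0012 L8–L18)] -/
theorem cmIPow_nsmul_tauOne (k m : ℕ) : cmIPow D.im D.im_sq k (m • (tauOne : APoint D.H)) = m • tauOne := by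
  induction k with
  | zero => rfl
  | succ k ih =>
    show cmI D.im D.im_sq (cmIPow D.im D.im_sq k (m • tauOne)) = m • tauOne
    rw [ih, map_nsmul, cmI_tauOne]

/-- `−(m·τ(1)) = m·τ(1)` (`2τ(1) = 0`). [cite: TianYuanZhang2017, Lemma 3.16 (p0017 L105–L113)] -/
theorem neg_nsmul_tauOne {H : Type} [Field H] [CharZero H] (m : ℕ) : -(m • (tauOne : APoint H)) = m • tauOne := by
  rw [neg_eq_iff_add_eq_zero, ← two_nsmul, ← mul_nsmul', nsmul_tauOne_eq_mod_two, Nat.mul_mod_right, zero_smul]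

/-- `L • (b·τ(1)) = (|L|·b)·τ(1)` for an integer `L` (sign immaterial since `2τ(1) = 0`). [cite: TianYuanZhang2017, Lemma 3.16 (p0017 L105–L113)] -/
theorem zsmul_nsmul_tauOne {H : Type} [Field H] [CharZero H] (L : ℤ) (b : ℕ) :
    L • (b • (tauOne : APoint H)) = (L.natAbs * b) • tauOne := by
  rcases Int.natAbs_eq L with h | h
  · conv_lhs => rw [h]
    rw [natCast_zsmul, ← mul_nsmul']
  · conv_lhs => rw [h]
    rw [neg_zsmul, natCast_zsmul, ← mul_nsmul', neg_nsmul_tauOne]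

/-- An EVEN multiple of `τ(1)` vanishes. [cite: TianYuanZhang2017, Lemma 3.16 (p0017 L105–L113)] -/
theorem nsmul_tauOne_eq_zero_of_even {H : Type} [Field H] [CharZero H] {m : ℕ} (hm : Even m) :
    m • (tauOne : APoint H) = 0 := by
  rw [nsmul_tauOne_eq_mod_two, Nat.even_iff.mp hm, zero_smul]

/-! ## §2 Prime blocks: the recursion is empty -/

/-- **`P(p) = Z(p)` for a PRIME block `p ∣ n`, `p ≡ 5, 6, 7 (mod 8)`.** [cite: TianYuanZhang2017, §3.1 (p0011 L67–L70)] -/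
theorem P_eq_Z_of_prime (hrec : D.recursion) {p : ℕ} (hp : p.Prime) (hpn : p ∈ n.divisors)
    (h8 : p % 8 = 5 ∨ p % 8 = 6 ∨ p % 8 = 7) : D.P p = D.Z p := by
  rw [hrec p hpn h8, recursionIndex_prime hp, Finset.sum_empty, sub_zero]

/-! ## §3 Every block's genus period moves by an integer multiple of `τ(1)` -/

/-- **`g·Z(d₀) ∈ Z(d₀) + ℕ·τ(1)`** on a block `d₀ ≡ 5, 6 (mod 8)` of the CM-point display, for every `g` trivial on `L_{d₀}(i)` (TYZ p. 759
«`αΦ₀` is also a set of representatives … `Z(n)^α − Z(n) ∈ ℤτ(1)`»; the tree's `ThetaDescent.sum_thetaPt_reindex`).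
[cite: TianYuanZhang2017, proof of Lemma 3.21 (p0020 L55–L62) and Thm. 3.6 (1)(2) (p0012 L27–L33)] -/
theorem exists_galPt_Z_eq_add_nsmul_of_cmBlockSpec {d₀ : ℕ}
    {z : APoint D.H} {Φ : Finset (D.H ≃ₐ[ℚ] D.H)} {ΓH ΓH' : Subgroup (D.H ≃ₐ[ℚ] D.H)} {σ c : D.H ≃ₐ[ℚ] D.H}
    (h : D.CMBlockSpec d₀ z Φ ΓH ΓH' σ c) {g : D.H ≃ₐ[ℚ] D.H} (hg : D.TrivialOnL d₀ g) :
    ∃ m : ℕ, D.galPt g (D.Z d₀) = D.Z d₀ + m • tauOne := by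
  obtain ⟨⟨hZ, -⟩, hΦL, ⟨hΓz, hΓn, -⟩, -, -, ⟨-, hσσ, hσz⟩, hrep, huniq⟩ := h
  have hex : ∀ t ∈ Φ, ∃ r ∈ Φ, g * t * r⁻¹ ∈ ΓH' ∨ g * t * (r * σ)⁻¹ ∈ ΓH' := fun t ht =>
    hrep (g * t) (trivialOnL_mul D hg (hΦL t ht))
  have hinj : ∀ t₁ ∈ Φ, ∀ t₂ ∈ Φ, (g * t₁ * (g * t₂)⁻¹ ∈ ΓH' ∨ g * t₁ * (g * t₂ * σ)⁻¹ ∈ ΓH') → t₁ = t₂ := by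
    intro t₁ ht₁ t₂ ht₂ h12
    apply huniq t₁ ht₁ t₂ ht₂
    rcases h12 with h12 | h12
    · left
      have := hΓn g⁻¹ _ h12
      rwa [show g⁻¹ * (g * t₁ * (g * t₂)⁻¹) * g⁻¹⁻¹ = t₁ * t₂⁻¹ by group] at this
    · right
      have := hΓn g⁻¹ _ h12
      rwa [show g⁻¹ * (g * t₁ * (g * t₂ * σ)⁻¹) * g⁻¹⁻¹ = t₁ * (t₂ * σ)⁻¹ by group] at this
  obtain ⟨m, hm⟩ := sum_thetaPt_reindex D ΓH' z hΓn hΓz hσσ hσz Φ (g * ·) hex hinj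
  refine ⟨m.natAbs, ?_⟩
  rw [hZ, map_sum]
  have e : ∑ t ∈ Φ, D.galPt g (D.galPt t z) = ∑ t ∈ Φ, thetaPt D (g * t) z :=
    Finset.sum_congr rfl fun t _ => (galPt_mul D g t z).symm
  have e2 : m • (tauOne : APoint D.H) = m.natAbs • tauOne := by
    have := zsmul_nsmul_tauOne (H := D.H) m 1
    rwa [one_nsmul, mul_one] at this
  rw [e, hm]
  change ∑ t ∈ Φ, D.galPt t z + m • tauOne = ∑ t ∈ Φ, D.galPt t z + m.natAbs • tauOne
  rw [e2]

/-! ## §4 From `Z(d)` to `P(d)` through the recursion -/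

/-- **The lower sum of the recursion moves by `(Σ |𝓛(d/d₀)|·m(d₀))·τ(1)`** when `g(i) = i` and each `P(d₀)` moves by `m(d₀)·τ(1)`.
[cite: TianYuanZhang2017, §3.1 (p0011 L67–L73) and Lemma 3.16 (p0017 L105–L113)] -/
theorem galPt_recursionSum_eq_add (g : D.H ≃ₐ[ℚ] D.H) (hgi : g D.im = D.im) (d : ℕ) (m : ℕ → ℕ)
    (hm : ∀ d₀ ∈ recursionIndex d, D.galPt g (D.P d₀) = D.P d₀ + m d₀ • tauOne) :
    D.galPt g (∑ d₀ ∈ recursionIndex d, cmIPow D.im D.im_sq (D.eps d₀ (d / d₀)) (D.scriptL (d / d₀) • D.P d₀)) =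
      (∑ d₀ ∈ recursionIndex d, cmIPow D.im D.im_sq (D.eps d₀ (d / d₀)) (D.scriptL (d / d₀) • D.P d₀)) +
        (∑ d₀ ∈ recursionIndex d, (D.scriptL (d / d₀)).natAbs * m d₀) • tauOne := by
  rw [map_sum, Finset.sum_smul, ← Finset.sum_add_distrib]
  refine Finset.sum_congr rfl fun d₀ hd₀ => ?_
  rw [galPt_cmIPow_of_fix D g hgi, map_zsmul, hm d₀ hd₀, smul_add, map_add, zsmul_nsmul_tauOne, cmIPow_nsmul_tauOne]

/-- **`g·P(d) = P(d) + a·τ(1)` from `g·Z(d) = Z(d) + a·τ(1)` when every lower term contributes an EVEN multiple of `τ(1)`** (`g(i) = i`;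
each `d₀ ∈ recursionIndex d` has `g·P(d₀) = P(d₀) + m(d₀)·τ(1)` with `𝓛(d/d₀)·m(d₀)` even — e.g. `𝓛(d/d₀)` even, or `P(d₀)` fixed).
[cite: TianYuanZhang2017, §3.1 (p0011 L67–L73), proof of Lemma 3.21 (p0020 L27–L63)] -/
theorem galPt_P_eq_add_of_even_mul (hrec : D.recursion) {d : ℕ} (hd : d ∈ n.divisors) (hd8 : d % 8 = 5 ∨ d % 8 = 6 ∨ d % 8 = 7)
    (g : D.H ≃ₐ[ℚ] D.H) (hgi : g D.im = D.im) {a : ℕ} (hZ : D.galPt g (D.Z d) = D.Z d + a • tauOne) (m : ℕ → ℕ)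
    (hm : ∀ d₀ ∈ recursionIndex d, D.galPt g (D.P d₀) = D.P d₀ + m d₀ • tauOne)
    (heven : ∀ d₀ ∈ recursionIndex d, Even ((D.scriptL (d / d₀)).natAbs * m d₀)) :
    D.galPt g (D.P d) = D.P d + a • tauOne := by
  have hS := galPt_recursionSum_eq_add D g hgi d m hm
  have h0 : (∑ d₀ ∈ recursionIndex d, (D.scriptL (d / d₀)).natAbs * m d₀) • (tauOne : APoint D.H) = 0 :=
    nsmul_tauOne_eq_zero_of_even (Finset.even_sum _ fun d₀ hd₀ => heven d₀ hd₀)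
  rw [h0, add_zero] at hS
  rw [hrec d hd hd8, map_sub, hZ, hS]
  abel

/-- **`g·P(d) ≠ P(d) ⟺ g·Z(d) ≠ Z(d)`** under the same evenness of the lower contributions (`g·Z(d) − Z(d) ∈ ℕ·τ(1)` given).
[cite: TianYuanZhang2017, §3.1 (p0011 L67–L73), proof of Lemma 3.21 (p0020 L27–L63)] -/
theorem galPt_P_ne_iff_of_even_mul (hrec : D.recursion) {d : ℕ} (hd : d ∈ n.divisors) (hd8 : d % 8 = 5 ∨ d % 8 = 6 ∨ d % 8 = 7)
    (g : D.H ≃ₐ[ℚ] D.H) (hgi : g D.im = D.im) (hZ : ∃ a : ℕ, D.galPt g (D.Z d) = D.Z d + a • tauOne) (m : ℕ → ℕ)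
    (hm : ∀ d₀ ∈ recursionIndex d, D.galPt g (D.P d₀) = D.P d₀ + m d₀ • tauOne)
    (heven : ∀ d₀ ∈ recursionIndex d, Even ((D.scriptL (d / d₀)).natAbs * m d₀)) :
    D.galPt g (D.P d) ≠ D.P d ↔ D.galPt g (D.Z d) ≠ D.Z d := by
  obtain ⟨a, ha⟩ := hZ
  rw [galPt_P_eq_add_of_even_mul D hrec hd hd8 g hgi ha m hm heven, ha]
  simp only [ne_eq, add_eq_left]

/-! ## §5 Every block's genus point moves by an integer multiple of `τ(1)` -/

/-- **All genus points `P(d)` (blocks `d ∣ n`, `d ≡ 5, 6, 7 (mod 8)`) move by multiples of `τ(1)`** under an automorphism `g` fixing `i` which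
moves every block's genus PERIOD `Z(d)` by a multiple of `τ(1)` (strong induction through the recursion; the lower blocks `d₀ ∈ recursionIndex d`
are proper divisors of `d`, themselves blocks). [cite: TianYuanZhang2017, §3.1 (p0011 L67–L73), proof of Lemma 3.21 (p0020 L27–L63)] -/
theorem exists_galPt_P_eq_add_nsmul (hrec : D.recursion) (g : D.H ≃ₐ[ℚ] D.H) (hgi : g D.im = D.im)
    (hZ : ∀ d ∈ n.divisors, (d % 8 = 5 ∨ d % 8 = 6 ∨ d % 8 = 7) → ∃ a : ℕ, D.galPt g (D.Z d) = D.Z d + a • tauOne) :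
    ∀ d ∈ n.divisors, (d % 8 = 5 ∨ d % 8 = 6 ∨ d % 8 = 7) → ∃ m : ℕ, D.galPt g (D.P d) = D.P d + m • tauOne := by
  intro d
  induction d using Nat.strong_induction_on with
  | _ d ih =>
    intro hd hd8
    -- the lower blocks
    have hlow : ∀ d₀ ∈ recursionIndex d, ∃ m : ℕ, D.galPt g (D.P d₀) = D.P d₀ + m • tauOne := by
      intro d₀ hd₀
      simp only [recursionIndex, Finset.mem_filter, Nat.mem_divisors] at hd₀
      obtain ⟨⟨hdvd, hd0⟩, h8₀, -, hgt⟩ := hd₀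
      have hd₀n : d₀ ∈ n.divisors :=
        Nat.mem_divisors.mpr ⟨hdvd.trans (Nat.dvd_of_mem_divisors hd), (Nat.mem_divisors.mp hd).2⟩
      have hlt : d₀ < d := by
        obtain ⟨k, hk⟩ := hdvd
        have hk0 : 0 < d₀ := Nat.pos_of_ne_zero (by rintro rfl; simp at hk; exact hd0 hk)
        have : d / d₀ = k := by rw [hk, Nat.mul_div_cancel_left k hk0]
        rw [this] at hgt
        nlinarith
      exact ih d₀ hlt hd₀n h8₀
    choose! m hm using hlow
    obtain ⟨a, ha⟩ := hZ d hd hd8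
    refine ⟨a + ∑ d₀ ∈ recursionIndex d, (D.scriptL (d / d₀)).natAbs * m d₀, ?_⟩
    have hS := galPt_recursionSum_eq_add D g hgi d m hm
    rw [hrec d hd hd8, map_sub, ha, hS, add_smul]
    -- `Z + aτ − (S + cτ) = Z − S + (aτ + cτ)` using `−cτ = cτ`
    have key : ∀ (Z S T U : APoint D.H), -U = U → Z + T - (S + U) = Z - S + (T + U) := by
      intro Z S T U hU
      rw [show Z + T - (S + U) = Z - S + (T + -U) by abel, hU]
    exact key _ _ _ _ (neg_nsmul_tauOne _)

end Summit.BirchSwinnertonDyer.Rank1Residual.P2.GenusPeriodTransferLayer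

end
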